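import Mathlib
import Summits.Ventures.PercRepro2.Defs
import Summits.Ventures.PercRepro2.Independence
import Summits.Ventures.PercRepro2.Harris
import Summits.Ventures.PercRepro2.Graph
import Summits.Ventures.PercRepro2.Events
import Summits.Ventures.PercRepro2.ZCLeafBuilt
import Summits.Ventures.PercRepro2.ZCInsertP

/-!
# (ZC) along a chain of root insertions (Theorems F and H) — the root travelling along a chain
(blind cell PercRepro2, mine-a g24; MINE-A.md §72.9)

A ROOT CHAIN is a list of records `(f₁, f₂, v, w)`: the vertex `v` carries the edges `f₁ = va₃` or
`f₁ = vo` (to one of the two fixed marks — Theorem F or Theorem H) and `f₂ = vw`, and the next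
record's vertex is this record's `w` (`List.IsChain`).  Starting from the marks `(a₁, a₃, o)` with
`a₁ = v` of the first record, the `p`-forms of F / H strip the records one after another — the ROOT
travels along the chain — until the weights `L.foldl (fun q r => q[r.f₁, r.f₂ ↦ 0]) p` are reached,
with the root at the last record's `w`.  **Theorem** (`zc_of_root_chain`): if those final weights
satisfy (ZC) for the final marks and EVERY up-set, then (ZC) holds for `p` and the original marks and
up-set (the degenerate case `{root} ∈ 𝓔` gives (ZC) `= 0`, `zc_eq_zero_of_singleton_mem`).  No
definition; one seat.
-/

namespace Summit.Ventures.PercRepro2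

section RootChain

variable {V : Type*} {E : Type*} [Fintype E] [DecidableEq E] {R : Type*} [CommRing R]
  [LinearOrder R] [IsStrictOrderedRing R]

/-- **(ZC) along a chain of root insertions (Theorems F and H).** -/
theorem zc_of_root_chain {ends : E → Sym2 V} (a₃ o : V) (L : List (E × E × V × V))
    (hrec : ∀ r ∈ L, (ends r.1 = s(r.2.2.1, a₃) ∨ ends r.1 = s(r.2.2.1, o))
      ∧ ends r.2.1 = s(r.2.2.1, r.2.2.2) ∧ r.1 ≠ r.2.1 ∧ r.2.2.1 ≠ a₃ ∧ r.2.2.1 ≠ o)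
    (hchain : List.IsChain (fun r r' => r.2.2.2 = r'.2.2.1) L)
    (hpair : L.Pairwise (fun r r' => r.2.2.1 ∉ ends r'.1 ∧ r.2.2.1 ∉ ends r'.2.1)) :
    ∀ (p : E → R), IsProbVec p →
    (∀ r ∈ L, ∀ e, r.2.2.1 ∈ ends e → (∃ r' ∈ L, e = r'.1 ∨ e = r'.2.1) ∨ p e = 0) →
    ∀ (a₁ : V) (𝓔 : Set (Set V)), IsUpperSet 𝓔 → (∀ r, L.head? = some r → r.2.2.1 = a₁) →
    (∀ 𝓔' : Set (Set V), IsUpperSet 𝓔' →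
      let p₀ := L.foldl (fun q r => Function.update (Function.update q r.1 0) r.2.1 0) p
      let a₁' := L.foldl (fun _ r => r.2.2.2) a₁
      let e := connEvent ends a₁' a₃
      let L' := connEvent ends a₁' o
      let U := clusterInEvent ends a₁' 𝓔'
      let γ := connEvent ends a₃ o
      0 ≤ prob p₀ (eᶜ ∩ L'ᶜ ∩ γᶜ) * (prob p₀ (U ∩ (e ∩ L')) - prob p₀ U * prob p₀ (e ∩ L'))
        - prob p₀ (eᶜ ∩ L'ᶜ ∩ γ) * (prob p₀ (U ∩ (e ∩ L'ᶜ)) - prob p₀ U * prob p₀ (e ∩ L'ᶜ))) →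
    let e := connEvent ends a₁ a₃
    let L' := connEvent ends a₁ o
    let U := clusterInEvent ends a₁ 𝓔
    let γ := connEvent ends a₃ o
    0 ≤ prob p (eᶜ ∩ L'ᶜ ∩ γᶜ) * (prob p (U ∩ (e ∩ L')) - prob p U * prob p (e ∩ L'))
      - prob p (eᶜ ∩ L'ᶜ ∩ γ) * (prob p (U ∩ (e ∩ L'ᶜ)) - prob p U * prob p (e ∩ L'ᶜ)) := by
  induction L with
  | nil =>
    intro p _ _ a₁ 𝓔 h𝓔 _ hbase
    have h := hbase 𝓔 h𝓔
    simpa using h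
  | cons r L ih =>
    intro p hp hzero a₁ 𝓔 h𝓔 hhead hbase
    obtain ⟨f₁, f₂, v, w⟩ := r
    have hv : v = a₁ := hhead (f₁, f₂, v, w) rfl
    subst hv
    obtain ⟨hends₁, hends₂, hf, h13, h1o⟩ := hrec (f₁, f₂, v, w) List.mem_cons_self
    simp only at hends₁ hends₂ hf h13 h1o
    have hrec' : ∀ r ∈ L, (ends r.1 = s(r.2.2.1, a₃) ∨ ends r.1 = s(r.2.2.1, o))
        ∧ ends r.2.1 = s(r.2.2.1, r.2.2.2) ∧ r.1 ≠ r.2.1 ∧ r.2.2.1 ≠ a₃ ∧ r.2.2.1 ≠ o :=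
      fun r hr => hrec r (List.mem_cons_of_mem _ hr)
    have hchain' : List.IsChain (fun r r' => r.2.2.2 = r'.2.2.1) L := hchain.tail
    have hpair' : L.Pairwise (fun r r' => r.2.2.1 ∉ ends r'.1 ∧ r.2.2.1 ∉ ends r'.2.1) :=
      (List.pairwise_cons.1 hpair).2
    have hhead' : ∀ r' ∈ L, v ∉ ends r'.1 ∧ v ∉ ends r'.2.1 := (List.pairwise_cons.1 hpair).1
    -- the `p`-forms of Theorems F / H at the root `v`
    have hmark : ∀ e, v ∈ ends e → e = f₁ ∨ e = f₂ ∨ p e = 0 := by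
      intro e he
      rcases hzero (f₁, f₂, v, w) List.mem_cons_self e he with ⟨r', hr', h⟩ | h
      · rcases List.mem_cons.1 hr' with rfl | hr'
        · simp only at h
          rcases h with rfl | rfl
          · exact Or.inl rfl
          · exact Or.inr (Or.inl rfl)
        · exfalso
          rcases h with rfl | rfl
          · exact (hhead' r' hr').1 he
          · exact (hhead' r' hr').2 he
      · exact Or.inr (Or.inr h)
    simp only
    -- the inductive hypothesis for the tail, under `p[f₁, f₂ ↦ 0]` and the shifted up-set
    set p' := Function.update (Function.update p f₁ 0) f₂ 0 with hp'def
    have hp' : IsProbVec p' := (hp.update f₁ le_rfl zero_le_one).update f₂ le_rfl zero_le_one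
    have hzero' : ∀ r ∈ L, ∀ e, r.2.2.1 ∈ ends e → (∃ r' ∈ L, e = r'.1 ∨ e = r'.2.1) ∨ p' e = 0 := by
      intro r hr e he
      rcases hzero r (List.mem_cons_of_mem _ hr) e he with ⟨r', hr', h⟩ | h
      · rcases List.mem_cons.1 hr' with rfl | hr'
        · right
          simp only at h
          rcases h with rfl | rfl
          · simp [hp'def, Function.update_of_ne hf]
          · simp [hp'def]
        · exact Or.inl ⟨r', hr', h⟩
      · right
        by_cases h2 : e = f₂
        · subst h2; simp [hp'def]
        · by_cases h1 : e = f₁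
          · subst h1; simp [hp'def, Function.update_of_ne h2]
          · rw [hp'def, Function.update_of_ne h2, Function.update_of_ne h1]; exact h
    have hhead'' : ∀ r', L.head? = some r' → r'.2.2.1 = w := by
      intro r' hr'
      exact ((List.isChain_cons.1 hchain).1 r' hr').symm
    have hbase' : ∀ 𝓔' : Set (Set V), IsUpperSet 𝓔' →
        let p₀ := L.foldl (fun q r => Function.update (Function.update q r.1 0) r.2.1 0) p'
        let a₁' := L.foldl (fun _ r => r.2.2.2) w
        let e := connEvent ends a₁' a₃
        let L' := connEvent ends a₁' o
        let U := clusterInEvent ends a₁' 𝓔'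
        let γ := connEvent ends a₃ o
        0 ≤ prob p₀ (eᶜ ∩ L'ᶜ ∩ γᶜ) * (prob p₀ (U ∩ (e ∩ L')) - prob p₀ U * prob p₀ (e ∩ L'))
          - prob p₀ (eᶜ ∩ L'ᶜ ∩ γ) * (prob p₀ (U ∩ (e ∩ L'ᶜ)) - prob p₀ U * prob p₀ (e ∩ L'ᶜ)) := by
      intro 𝓔' h𝓔'
      have h := hbase 𝓔' h𝓔'
      simp only [List.foldl_cons] at h ⊢
      exact h
    have hIH := ih hrec' hchain' hpair' p' hp' hzero' w _ (isUpperSet_rootShift h𝓔 v) hhead'' hbase'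
    simp only at hIH
    by_cases h𝓔₁ : ({v} : Set V) ∈ 𝓔
    · have := zc_eq_zero_of_singleton_mem p ends v a₃ o h𝓔 h𝓔₁
      simp only at this
      rw [this]
    rcases hends₁ with h₁ | h₁
    · exact zc_rootw_graph' hp hf h₁ hends₂ hmark h13 h1o h𝓔 h𝓔₁ hIH
    · exact zc_rootow_graph' hp hf h₁ hends₂ hmark h13 h1o h𝓔 h𝓔₁ hIH

end RootChain

end Summit.Ventures.PercRepro2
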